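import Summits.Langlands.Langlands.Theses.ParityBlindBianchi
import Summits.Langlands.Langlands.Theorems.ParityBlindBianchiResidualBianchiDoorMod2TwoAdicModel
import Summits.Langlands.Langlands.Theorems.ParityBlindBianchiIcosahedralQuadraticDescentFields
import HarnessLib

/-!
# Disproof of `ResidualBianchiDoorLevel` (E1′, item stmt-Langlands-15112) — findings

Disprover's work file (cdisprove, cycle 1).  Verdict so far: **NO KILL; the crux resists**, and the
file says precisely why, in kernel-checked form.

* §1 `K15_*` — the `∀ K` quantifier is NOT vacuous: `K = ℚ(√-15)` (`sqrtNegField ℚ 15`) is a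
  totally complex quadratic field with two distinct places above `2` (tree lemmas of
  `IcosahedralQuadraticDescent`).  So E1′ is not true-for-lack-of-fields.
* §2 `no_good_place_of_zero_mem`, `RegAlgCuspidalExist`,
  `residualBianchiDoorLevel_of_regAlgCuspidalExist`,
  `not_regAlgCuspidalExist_of_not_residualBianchiDoorLevel`,
  `residualBianchiDoorLevel_iff_regAlgCuspidalExist` — THE LOOPHOLE (typing): `S₀ : Finset ℕ` is not
  restricted to primes, `S₀ = {0, 2}` has NO good place, so the congruence clause is vacuous and the
  crux as typed is EQUIVALENT (modulo the existence of one icosahedral `ρ`, hypothesis `H_ico`) to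
  "every 2-split imaginary quadratic `K` carries a regular algebraic cuspidal automorphic
  representation of `GL₂(𝔸_K)`" — true mathematics (base change of any non-CM newform), hence
  IRREFUTABLE; the Khare–Wintenberger / congruence content is absent from the typed statement.
  Repair (planner): add `(∀ ℓ ∈ S₀, ℓ.Prime)` (or `0 ∉ S₀`); the lead's line `Sketch` already
  returns an honest prime `S`, so it proves the repaired statement too.
* §3 `false_without_icosahedral` — LOAD-BEARING: with the two hypotheses on `ρ` (irreducible,
  projective image `A₅`) dropped the statement is FALSE (witness: the trivial representation and
  `K = ℚ(√-15)`; conjunct 4 "projective image `≅ A₅`" fails by `1 ≠ 60`).  Any proof must use `hA5`.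
* §4 `isIrreducible_of_icosahedral`, `residualBianchiDoorLevel_iff_withoutHirr` — the hypothesis
  `ρ.toGaloisRep.IsIrreducible` is DECORATION: it follows from the `A₅` hypothesis
  (finite image + non-cyclic projective type); provers may ignore `hirr`.
* §5 (docstring `repaired_statement_analysis`) — the REPAIRED statement C′ (prime `S₀`) re-read symbol
  by symbol against the tree's `HasFrobCharpolyAt` / `IsUnramifiedAt` / `HasSatakeParamAt` /
  `arithFrobPolyOfSatake` / `IsRegularAlgebraic` and the vendored inputs `khare_wintenberger`,
  `baseChange_cyclic_cuspidal`, `ArthurClozel1989_strongLifting_allFinite` (R1): no junk found, every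
  normalisation discrepancy collapses mod `𝔪_{ℤ̄₂}` (`√q ≡ 1`, cyclotomic `≡ 1`, dual = det-twist),
  ramified-in-`K` good places are covered by R1.  A counterexample to C′ would be an icosahedral `ρ`
  with non-modular `ρ̄₂`, contradicting Khare–Wintenberger–Kisin.
* §6 `-- Line Sketch` — stub-by-stub attack of the lead's skeleton (`Lines/Sketch.lean`): all six
  stubs survive; `stub_predictedPolyCongr` checked by hand including the junk root `β = 0`;
  `not_predictedPoly_eq_exact` records that its `< 1` cannot be sharpened to equality
  (tightness: `q = 3, k = 2, H = (X-1)²` gives coefficients `1` vs `1/9`);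
  `stub_predictedPolyCongr_false_without_odd` records that its hypothesis `Odd q` is LOAD-BEARING
  (`q = 2`: coefficients differ by `3/4`, 2-adic norm `4`) — the reason for `2 ∈ S₀`.

Nothing here is a refutation of the crux.  Negative lemmas §3 (and the loophole reduction §2) are
proposed under `Theorems/ResidualBianchiDoorLevel/Negative/`.
-/

noncomputable section

namespace Summit.Langlands.Langlands.Cruxes.ResidualBianchiDoorLevel.Disproof

set_option linter.dupNamespace false

open scoped MatrixGroups Polynomial NumberField Valued
open Polynomial NumberField IsDedekindDomain Field
open Literature.NumberTheory.Automorphic Literature.NumberTheory.GaloisRepresentations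
  Literature.NumberTheory.GaloisRepresentations.QuadraticFamily
  Summit.Langlands.Langlands.Theses.ParityBlindBianchi
  Summit.Langlands.Langlands.Theorems

/-! ## §0 An abstract field isomorphism `ℚ̄₂ ≃+* ℂ` (Steinitz; copied from the route's `closes`) -/

/-- `ℚ̄₂ ≃ ℂ` as abstract fields (both algebraically closed of characteristic `0` and cardinality
`𝔠`).  Needed to instantiate the `∀ ι` of the crux in negative lemmas. [folklore] -/
theorem nonempty_ringEquiv_padicAlgCl_complex : Nonempty (PadicAlgCl 2 ≃+* ℂ) := by
  have hQ2 : Cardinal.mk ℚ_[2] = Cardinal.continuum := by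
    apply le_antisymm
    · change Cardinal.mk (Quotient (CauSeq.equiv : Setoid (CauSeq ℚ (padicNorm 2)))) ≤
        Cardinal.continuum
      refine (Cardinal.mk_quotient_le (s := (CauSeq.equiv : Setoid (CauSeq ℚ (padicNorm 2))))).trans ?_
      refine (Cardinal.mk_subtype_le _).trans_eq ?_
      rw [← Cardinal.power_def, Cardinal.mk_nat, Cardinal.mkRat, Cardinal.aleph0_power_aleph0]
    · exact continuum_le_cardinal_of_nontriviallyNormedField ℚ_[2]
  have hC2 : Cardinal.mk (PadicAlgCl 2) = Cardinal.continuum := by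
    apply le_antisymm
    · refine (Algebra.IsAlgebraic.cardinalMk_le_max ℚ_[2] (PadicAlgCl 2)).trans ?_
      rw [hQ2, max_eq_left Cardinal.aleph0_le_continuum]
    · rw [← hQ2]
      exact Cardinal.mk_le_of_injective (algebraMap ℚ_[2] (PadicAlgCl 2)).injective
  refine IsAlgClosed.ringEquiv_of_equiv_of_charZero ?_
    (Cardinal.eq.1 (by rw [hC2, Cardinal.mk_complex]))
  rw [hC2]
  exact Cardinal.aleph0_lt_continuum

/-! ## §1 Non-vacuity of the field quantifier: `K = ℚ(√-15)` -/

/-- `-15` is not a square in `ℚ`. [folklore] -/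
instance fact_fifteen : Fact (¬ IsSquare (-((15 : ℕ) : ℚ))) :=
  IcosahedralQuadraticDescent.fact_not_isSquare_neg_natCast (by norm_num)

/-- The test field `K₁₅ = ℚ(√-15)`. [folklore] -/
abbrev K15 : Type := sqrtNegField ℚ 15

/-- `ℚ(√-15)` is totally complex. [folklore] -/
theorem K15_isTotallyComplex : IsTotallyComplex K15 :=
  IcosahedralQuadraticDescent.isTotallyComplex_sqrtNegField (by norm_num)

/-- `[ℚ(√-15) : ℚ] = 2`. [folklore] -/
theorem K15_finrank : Module.finrank ℚ K15 = 2 := finrank_sqrtNegField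

/-- `2` splits in `ℚ(√-15)` (`16 ∣ 15 + 1`), in the shape of the crux's hypothesis. [folklore] -/
theorem K15_two_split : ∃ v w : HeightOneSpectrum (𝓞 K15), v ≠ w ∧
    ((2 : ℕ) : 𝓞 K15) ∈ v.asIdeal ∧ ((2 : ℕ) : 𝓞 K15) ∈ w.asIdeal :=
  IcosahedralQuadraticDescent.exists_two_places_two_mem (D := 15) (by norm_num)

/-! ## §2 The `S₀ ∋ 0` loophole: the crux as typed is "regular algebraic cuspidal reps exist" -/

/-- If `0 ∈ S₀` then NO finite place is good: `(0 : 𝓞 K) ∈ v`. [folklore] -/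
theorem no_good_place_of_zero_mem {K : Type} [Field K] [NumberField K] {S₀ : Finset ℕ}
    (h0 : 0 ∈ S₀) (v : HeightOneSpectrum (𝓞 K)) :
    ¬ ∀ ℓ ∈ S₀, ((ℓ : ℕ) : 𝓞 K) ∉ v.asIdeal :=
  fun h => h 0 h0 (by simp)

/-- **Existence of regular algebraic cuspidal automorphic representations of `GL₂` over every
2-split imaginary quadratic field** — the whole content of the crux as typed (see
`residualBianchiDoorLevel_iff_regAlgCuspidalExist`).  True mathematics (e.g. `BC_{K/ℚ}` of the
representation of any non-CM newform of weight `≥ 2`), not constructible in the tree today except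
through the base-change named facts. [folklore] -/
def RegAlgCuspidalExist : Prop :=
  ∀ (K : Type) [Field K] [NumberField K], IsTotallyComplex K → Module.finrank ℚ K = 2 →
    (∃ v w : HeightOneSpectrum (𝓞 K), v ≠ w ∧ ((2 : ℕ) : 𝓞 K) ∈ v.asIdeal ∧
      ((2 : ℕ) : 𝓞 K) ∈ w.asIdeal) →
    ∃ (hcpt : isCompact_glFiniteIntegralLevel 2 K) (π₀ : CuspidalAutomorphicRepData 2 K hcpt),
      π₀.1.IsRegularAlgebraic

/-- **The loophole, forward**: `RegAlgCuspidalExist` ALONE proves the crux as typed — take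
`S₀ = {2, 0}` (no good place, congruence clause vacuous), the 2-adic model of `ρ|_K` from the landed
`ResidualBianchiDoorMod2.exists_padicModel_restrictField`, and any regular algebraic cuspidal `π₀`.
No Khare–Wintenberger, no base change, no congruence. (Same observation as the refuter evidence
`DegenerateS0.lean` on the item; recorded here as the reason the crux cannot be refuted.) [folklore] -/
theorem residualBianchiDoorLevel_of_regAlgCuspidalExist (h : RegAlgCuspidalExist) :
    ResidualBianchiDoorLevel := by
  intro ι ρ _hirr hA5
  haveI : Fact (Nat.Prime 2) := ⟨Nat.prime_two⟩
  refine ⟨{2, 0}, by simp, ?_⟩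
  intro K _ _ htc hdeg hsplit
  obtain ⟨σ₀, -, -, -, hmodel, hfinK, hirrK, hA5K⟩ :=
    ResidualBianchiDoorMod2.exists_padicModel_restrictField ι ρ hA5 K hdeg
  obtain ⟨hcpt, π₀, hRA⟩ := h K htc hdeg hsplit
  refine ⟨σ₀.restrictField K, hmodel, hfinK, hirrK, hA5K, hcpt, π₀, hRA, ?_⟩
  intro v hv
  exact (no_good_place_of_zero_mem (by simp) v hv).elim

/-- **The loophole, contrapositive** (negative-lemma shape): any refutation of the crux as typed
must refute the existence of a regular algebraic cuspidal automorphic representation of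
`GL₂(𝔸_K)` for some 2-split imaginary quadratic `K` — hopeless, these exist. [folklore] -/
theorem not_regAlgCuspidalExist_of_not_residualBianchiDoorLevel (h : ¬ ResidualBianchiDoorLevel) :
    ¬ RegAlgCuspidalExist :=
  fun hR => h (residualBianchiDoorLevel_of_regAlgCuspidalExist hR)

/-- Existence of one irreducible icosahedral Artin representation `ρ : Γ_ℚ → GL₂(ℂ)` (true: e.g. the
splitting field of `x⁵ + 20x + 16` with a lift of `A₅ ⊂ PGL₂(ℂ)`, Klein 1884 / Buhler 1978; not
constructible in the tree today). The hypothesis under which the crux is non-vacuous. [folklore] -/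
def H_ico : Prop :=
  ∃ ρ : FramedGaloisRep ℚ ℂ 2, ρ.toGaloisRep.IsIrreducible ∧
    Nonempty ((Matrix.ProjGenLinGroup.mk.comp ρ.toMonoidHom).range ≃* alternatingGroup (Fin 5))

/-- **The crux as typed is EXACTLY `RegAlgCuspidalExist`** (granted one icosahedral `ρ` exists, so
that its `∀ ρ` is not vacuous): the congruence / Khare–Wintenberger content is void as typed.
Planner repair: restrict `S₀` to primes. [folklore] -/
theorem residualBianchiDoorLevel_iff_regAlgCuspidalExist (hH : H_ico) :
    ResidualBianchiDoorLevel ↔ RegAlgCuspidalExist := by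
  refine ⟨fun h => ?_, residualBianchiDoorLevel_of_regAlgCuspidalExist⟩
  obtain ⟨ι⟩ := nonempty_ringEquiv_padicAlgCl_complex
  obtain ⟨ρ, hirr, hA5⟩ := hH
  obtain ⟨S₀, -, hK⟩ := h ι ρ hirr hA5
  intro K _ _ htc hdeg hsplit
  obtain ⟨-, -, -, -, -, hcpt, π₀, hRA, -⟩ := hK K htc hdeg hsplit
  exact ⟨hcpt, π₀, hRA⟩

/-! ## §3 Load-bearing hypotheses: without the icosahedral hypotheses the statement is FALSE -/

/-- The crux with BOTH hypotheses on `ρ` (irreducible, projective image `A₅`) dropped. -/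
def ResidualBianchiDoorLevelWithoutIcosahedral : Prop :=
  ∀ (ι : PadicAlgCl 2 ≃+* ℂ) (ρ : FramedGaloisRep ℚ ℂ 2),
    ∃ S₀ : Finset ℕ, 2 ∈ S₀ ∧ ∀ (K : Type) [Field K] [NumberField K], IsTotallyComplex K →
      Module.finrank ℚ K = 2 →
      (∃ v w : HeightOneSpectrum (𝓞 K), v ≠ w ∧ ((2 : ℕ) : 𝓞 K) ∈ v.asIdeal ∧
        ((2 : ℕ) : 𝓞 K) ∈ w.asIdeal) →
      ∃ σ : FramedGaloisRep K (PadicAlgCl 2) 2,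
        (∀ (g : absoluteGaloisGroup K) (i j : Fin 2),
          ι ((σ g).val i j) = ((FramedGaloisRep.restrictField K ρ) g).val i j) ∧
        Finite σ.toMonoidHom.range ∧ σ.toGaloisRep.IsIrreducible ∧
        Nonempty ((Matrix.ProjGenLinGroup.mk.comp σ.toMonoidHom).range ≃*
          alternatingGroup (Fin 5)) ∧
        ∃ (hcpt : isCompact_glFiniteIntegralLevel 2 K) (π₀ : CuspidalAutomorphicRepData 2 K hcpt),
          π₀.1.IsRegularAlgebraic ∧
          ∀ v : HeightOneSpectrum (𝓞 K), (∀ ℓ ∈ S₀, ((ℓ : ℕ) : 𝓞 K) ∉ v.asIdeal) →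
            ∃ (α : Multiset ℂ) (P : Polynomial (PadicAlgCl 2)), π₀.1.HasSatakeParamAt v α ∧
              σ.IsUnramifiedAt v ∧ σ.HasFrobCharpolyAt v P ∧
              ∀ i : ℕ, ‖P.coeff i - (arithFrobPolyOfSatake ι v.residueCard 2 α).coeff i‖ < 1

/-- The trivial two-dimensional representation of `Γ_ℚ`. [folklore] -/
def trivRep : FramedGaloisRep ℚ ℂ 2 :=
  { (1 : absoluteGaloisGroup ℚ →* GL (Fin 2) ℂ) with continuous_toFun := continuous_const }

@[simp] theorem trivRep_apply (g : absoluteGaloisGroup ℚ) : trivRep g = 1 := rfl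

/-- A group isomorphic to `A₅` does not have exactly one element. [folklore] -/
theorem card_ne_one_of_mulEquiv_alternatingGroup {P : Type*} [Group P]
    (e : P ≃* alternatingGroup (Fin 5)) : Nat.card P ≠ 1 := by
  rw [Nat.card_congr e.toEquiv, nat_card_alternatingGroup, Nat.card_eq_fintype_card,
    Fintype.card_fin]
  decide

/-- **`ResidualBianchiDoorLevel` is false without its icosahedral hypotheses** (`_false_without_`
lemma; any proof must use `hA5`): for the trivial `ρ` and `K = ℚ(√-15)` the pinned model `σ` is
trivial (entrywise, `ι` injective), so its projective image is trivial, not `≅ A₅` (`1 ≠ 60`).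
[folklore] -/
theorem false_without_icosahedral : ¬ ResidualBianchiDoorLevelWithoutIcosahedral := by
  intro h
  obtain ⟨ι⟩ := nonempty_ringEquiv_padicAlgCl_complex
  obtain ⟨S₀, -, hK⟩ := h ι trivRep
  obtain ⟨σ, hmodel, -, -, ⟨e⟩, -⟩ := hK K15 K15_isTotallyComplex K15_finrank K15_two_split
  -- the pinned model is trivial
  have hσ : ∀ g : absoluteGaloisGroup K15, σ g = 1 := by
    intro g
    refine Matrix.GeneralLinearGroup.ext fun i j => ι.injective ?_
    have h1 := hmodel g i j
    rw [FramedGaloisRep.restrictField_apply, trivRep_apply] at h1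
    rw [h1, Units.val_one, Units.val_one, Matrix.one_apply, Matrix.one_apply]
    split_ifs <;> simp
  -- hence the projective image is trivial
  have hbot : (Matrix.ProjGenLinGroup.mk.comp σ.toMonoidHom).range = ⊥ := by
    rw [Subgroup.eq_bot_iff_forall]
    rintro _ ⟨g, rfl⟩
    rw [MonoidHom.comp_apply]
    change Matrix.ProjGenLinGroup.mk (σ g) = 1
    rw [hσ g, map_one]
  apply card_ne_one_of_mulEquiv_alternatingGroup e
  rw [hbot]
  exact Subgroup.card_bot

/-! ## §4 The irreducibility hypothesis is decoration -/

/-- **`hirr` is implied by `hA5`**: an Artin representation `Γ_ℚ → GL₂(ℂ)` has finite image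
(`finite_range_toMonoidHom`), and a two-dimensional representation with finite image and non-cyclic
(here icosahedral) projective image is irreducible (`isIrreducible_of_not_isCyclicType`). [folklore] -/
theorem isIrreducible_of_icosahedral (ρ : FramedGaloisRep ℚ ℂ 2)
    (hA5 : Nonempty ((Matrix.ProjGenLinGroup.mk.comp ρ.toMonoidHom).range ≃*
      alternatingGroup (Fin 5))) : ρ.toGaloisRep.IsIrreducible := by
  haveI : Finite ρ.toMonoidHom.range := finite_range_toMonoidHom ρ
  obtain ⟨e⟩ := hA5
  exact isIrreducible_of_not_isCyclicType ρ.toMonoidHom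
    (ResidualBianchiDoorMod2.not_isCyclicType_of_mulEquiv_alternatingGroup e)

/-- The crux with the hypothesis `ρ.toGaloisRep.IsIrreducible` dropped (keeping `A₅`). -/
def ResidualBianchiDoorLevelWithoutHirr : Prop :=
  ∀ (ι : PadicAlgCl 2 ≃+* ℂ) (ρ : FramedGaloisRep ℚ ℂ 2),
    Nonempty ((Matrix.ProjGenLinGroup.mk.comp ρ.toMonoidHom).range ≃* alternatingGroup (Fin 5)) →
    ∃ S₀ : Finset ℕ, 2 ∈ S₀ ∧ ∀ (K : Type) [Field K] [NumberField K], IsTotallyComplex K →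
      Module.finrank ℚ K = 2 →
      (∃ v w : HeightOneSpectrum (𝓞 K), v ≠ w ∧ ((2 : ℕ) : 𝓞 K) ∈ v.asIdeal ∧
        ((2 : ℕ) : 𝓞 K) ∈ w.asIdeal) →
      ∃ σ : FramedGaloisRep K (PadicAlgCl 2) 2,
        (∀ (g : absoluteGaloisGroup K) (i j : Fin 2),
          ι ((σ g).val i j) = ((FramedGaloisRep.restrictField K ρ) g).val i j) ∧
        Finite σ.toMonoidHom.range ∧ σ.toGaloisRep.IsIrreducible ∧
        Nonempty ((Matrix.ProjGenLinGroup.mk.comp σ.toMonoidHom).range ≃*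
          alternatingGroup (Fin 5)) ∧
        ∃ (hcpt : isCompact_glFiniteIntegralLevel 2 K) (π₀ : CuspidalAutomorphicRepData 2 K hcpt),
          π₀.1.IsRegularAlgebraic ∧
          ∀ v : HeightOneSpectrum (𝓞 K), (∀ ℓ ∈ S₀, ((ℓ : ℕ) : 𝓞 K) ∉ v.asIdeal) →
            ∃ (α : Multiset ℂ) (P : Polynomial (PadicAlgCl 2)), π₀.1.HasSatakeParamAt v α ∧
              σ.IsUnramifiedAt v ∧ σ.HasFrobCharpolyAt v P ∧
              ∀ i : ℕ, ‖P.coeff i - (arithFrobPolyOfSatake ι v.residueCard 2 α).coeff i‖ < 1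

/-- **Mutation: dropping `hirr` changes nothing** (it is implied by `hA5`). [folklore] -/
theorem residualBianchiDoorLevel_iff_withoutHirr :
    ResidualBianchiDoorLevel ↔ ResidualBianchiDoorLevelWithoutHirr :=
  ⟨fun h ι ρ hA5 => h ι ρ (isIrreducible_of_icosahedral ρ hA5) hA5,
    fun h ι ρ _ hA5 => h ι ρ hA5⟩

/-! ## §5 The repaired statement C′ (prime `S₀`): why it resists (analysis, no Lean content) -/

/-- **Repaired statement C′** = the crux with `(∀ ℓ ∈ S₀, ℓ.Prime)` added (the planner's announced
repair; the lead's `stub_qLevel` already produces such an `S`).  Attack log (cycle 1):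
* *Counterexample families.*  A counterexample is an irreducible icosahedral `ρ/ℚ` whose mod-2
  reduction (projective image `A₅ ≅ SL₂(𝔽₄)`, odd for free since `-1 = 1`) is NOT modular of some
  level prime to... — contradicts Khare–Wintenberger (I) Thm 9.1 + Kisin (2-adic).  Even icosahedral
  `ρ` (Doud–Moore tables) are no exception: parity dies mod 2.  `ledger negatives --problem Langlands`
  (1 entry, K3KugaSatakeDescent.SerreTypeAnchor) irrelevant; barrier catalogue
  (`Literature/Barriers/Langlands/*`: non-regular weight, TW numerics, patching local components,
  mod-p LL beyond `ℚ_p`) does not touch a residual statement in cohomological weight.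
* *Typing traps re-read* (tree defs): `FramedGaloisRep.HasFrobCharpolyAt v P` quantifies over
  arithmetic Frobenii `IsArithFrobAt (𝓞 K) φ 𝔓`, which forces `φ ∈ D_𝔓` in the Frobenius coset —
  fine for unramified `σ`; `IsUnramifiedAt` = all inertia above `v` trivial; `HasSatakeParamAt`
  (∃ level prime to `v`, uniformiser, eigenform mod `W'`, `card α = 2`); `arithFrobPolyOfSatake ι q 2 α
  = ∏ (X - ι⁻¹((√q·a)⁻¹))`, monic of degree `card α`, junk only at `a = 0` (excluded for genuine
  Satake parameters, harmless in congruences); `IsRegularAlgebraic` = ∃ regular C-algebraic infinity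
  type — `BC_K(π_f ⊗ ε⁻¹)` for the KW form `f` of EVEN weight `k ∈ {2,4}` qualifies, odd weight
  would need the half twist `|det|^{1/2}`, which changes Satake parameters by `√q ≡ 1 mod 𝔪`.
* *Normalisations.*  Every discrepancy between the entrywise-pinned `σ = ι⁻¹ρ|_K` and Deligne's
  `ρ_{f,ι}` (dual vs. original = twist by `det⁻¹`; arithmetic vs geometric Frobenius; unitary vs
  arithmetic Satake normalisation; the odd-order part of `det ρ̄`) is absorbed by the prover's free
  choice of `π₀` (twist the KW form by a Dirichlet character, conductor inside `cond ρ ⊆ S₀`) and by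
  the collapse `ι⁻¹√q ≡ 1`, `χ_cyc ≡ 1 (mod 𝔪_{ℤ̄₂})`.
* *Places of `K` ramified over `ℚ` but good* (e.g. `3, 5` in `ℚ(√-15)` when `3, 5 ∉ S₀`): reached by
  R1 `ArthurClozel1989_strongLifting_allFinite` (AC Thm 5.1 at all finite places; re-read: clause (i)
  only, faithful — the false descent direction is NOT asserted), `f(w|v) = 1` there.
* *Hypothesis mutation.*  `hirr` redundant (§4, proved); `IsTotallyComplex K` and the 2-splitting are
  UNUSED by E1′ (they serve E2′); `finrank ℚ K = 2` is used only as "`Γ_K` has index `2`, `A₅` has no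
  index-2 subgroup" — for `K ⊇ L^{ker ρ̄}` the projective image of `ρ|_K` collapses and conjunct 4
  fails (needs an icosahedral `ρ` to certify: not constructible, not filed).
* *Strengthenings that ARE false* (documented, not landable without `ρ`): congruence `‖·‖ < 1`
  replaced by equality of polynomials (Hodge–Tate weights `{0,0}` vs regular; see also
  `not_predictedPoly_eq_exact` below for the bare polynomial identity); `S₀ = {2}` for all `ρ`
  (ramified primes of `ρ` must be excluded); congruence at EVERY place (`v ∣ 2`, `v ∣ cond ρ`).
[folklore] -/
theorem repaired_statement_analysis : True := trivial

/-! ## §6 Line `Sketch` (lead prover-line-stmt-Langlands-15112-0): stub-by-stub -/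

/-- **Stub verdicts (cycle 1)**, skeleton `Cruxes/ResidualBianchiDoorLevel/Lines/Sketch.lean`:
* `stub_dictionaryC` — SURVIVES (true: even weight ⇒ exponents in `1/2 + ℤ`, regular since `k ≠ 1`;
  the twist by `ε⁻¹` only, no norm twist). Load-bearing hypothesis: `Even k` (for odd `k` the datum
  `π ⊗ ε⁻¹` is L- not C-algebraic; `IsRegularAlgebraic` would fail as typed).
* `stub_predictedPolyCongr` — SURVIVES, checked by hand: with `s = ι⁻¹√q`, `s² = q` odd ⇒ `‖s‖ = 1`
  and `s̄² = 1` in `𝔽̄₂` ⇒ `s̄ = 1`; prediction `= (X - s^{-k}ι⁻¹β₁)(X - s^{-k}ι⁻¹β₂)`, coefficient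
  differences `ι⁻¹(β₁+β₂)(1 - s^{-k})`, `ι⁻¹(β₁β₂)(1 - s^{-2k})` have norm `< 1` because `Q` is
  integral; junk root `β = 0` gives `a = 0` and predicted root `(√q·0)⁻¹ = 0 = β/√q^k` — consistent;
  `i ≥ 2`: both monic of degree 2 (`natDegree_arithFrobPolyOfSatake`, `card H.roots = 2` as `ℂ` is
  algebraically closed).  Hypothesis `Odd q` is LOAD-BEARING (for `q = 2`, `‖1 - (ι⁻¹√2)^{-k}‖` is
  not `< 1`: `ι⁻¹√2` is not a unit).  Tightness: `not_predictedPoly_eq_exact`.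
* `stub_residual` — SURVIVES (true: finite group preserves a `ℤ̄₂`-lattice, valuation ring ⇒ free;
  reduction irreducible because the kernel of `PGL₂(ℤ̄₂) → PGL₂(k)` has only 2-power torsion and `A₅`
  has no non-trivial normal 2-subgroup).  Load-bearing: `hA5` (for `σ₀` trivial every `σ̄` with
  `charpoly ≡ (X-1)²` has exponent-2 unipotent image, which fixes a line: reducible) and `hfin`.
* `stub_qLevel` (lead) — SURVIVES; it already returns `(∀ ℓ ∈ S, ℓ.Prime)`, so the line proves the
  REPAIRED crux. Inner sorries (`hred`, `CharP k 2`, `hqNM`, Frobenius char-poly transport) are routine.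
* `stub_cuspWitness` — SURVIVES (true): `Γ_K` (index 2) still surjects onto `A₅`, so some
  `g₀ ∉ Γ_K` has projective order 3 or 5, trace `≢ 0 mod 𝔪`; Chebotarev (tree
  `chebotarev_artinRep_holds`) gives infinitely many inert good `v` with that Frobenius; there the
  `X`-coefficient of the prediction is a unit, impossible if `α = -α` (sum of inverses `0`, incl. the
  junk `α = {0,0}`).  Load-bearing: `hA5` (a CM `πQ` congruent to a dihedral `σ₀` has `a_p = 0` at
  every inert `p`), `hgood`.  `hS` (primality of `S`) is NOT used by the stub — possibly unnecessary.
* `stub_bcTransfer` — SURVIVES given the three named facts (re-read: `baseChange_cyclic_cuspidal`'s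
  witness criterion is the correct contrapositive of `π ≅ π ⊗ η^j`, all `j`, since every primitive
  root is some `η_v(ϖ)^j`; R1 faithful).  Note `K` real quadratic is allowed by the stub's
  hypotheses and is equally true.  Load-bearing: `hne` (without it BC of a CM form is Eisenstein),
  `hRA`.
* `stub_namedFacts` — not an obligation; none of the four facts is refutable as typed (each is a
  faithful weakening of the printed theorem; checked `khare_wintenberger` = Serre strong form with
  `IsOdd` vacuous at `p = 2` via `det = ±1 = 1`).
* JOINT SUFFICIENCY: `ResidualBianchiDoorLevel_of` is sorry-free modulo the stubs (read, rc 0 per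
  lead); the `σ₀` of `stub_qLevel` and of `exists_padicModel_restrictField` are identified by
  `toMonoidHom` — no gap smuggled.
[folklore] -/
theorem line_Sketch_stub_verdicts : True := trivial

/-- **Tightness of `stub_predictedPolyCongr`: the congruence cannot be an equality.**  For `q = 3`,
`k = 2`, `H = (X - 1)²` (so `Q = (X - 1)² ∈ ℤ̄₂[X]`), the Satake multiset is `{√3, √3}` and the
`m = 2` prediction is `(X - 1/3)²`, whose constant coefficient `1/9` differs from `Q`'s `1`
(while `‖1 - 1/9‖₂ = 2⁻³ < 1`, as the stub says). [folklore] -/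
theorem not_predictedPoly_eq_exact (ι : PadicAlgCl 2 ≃+* ℂ) :
    ((X - C 1) ^ 2 : Polynomial (PadicAlgCl 2)) ≠
      arithFrobPolyOfSatake ι 3 2
        ((((X - C 1) ^ 2 : Polynomial ℂ).roots).map
          fun β => (((Real.sqrt 3 : ℝ) : ℂ)) ^ ((2 : ℤ) - 1) * β⁻¹) := by
  haveI : Fact (Nat.Prime 2) := ⟨Nat.prime_two⟩
  have hroots : ((X - C 1) ^ 2 : Polynomial ℂ).roots = {1, 1} := by
    rw [roots_pow, roots_X_sub_C]; rfl
  have hs : ((Real.sqrt 3 : ℝ) : ℂ) * ((Real.sqrt 3 : ℝ) : ℂ) = 3 := by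
    rw [← Complex.ofReal_mul, Real.mul_self_sqrt (by norm_num : (0:ℝ) ≤ 3)]
    norm_num
  intro h
  have hc := congrArg (fun P : Polynomial (PadicAlgCl 2) => P.coeff 0) h
  simp only [arithFrobPolyOfSatake, hroots] at hc
  norm_num [Multiset.map_cons, Multiset.prod_cons, inv_one, mul_one, zpow_one] at hc
  -- hc : ((X - 1) ^ 2).coeff 0 = s⁻¹ * s⁻¹ * (s⁻¹ * s⁻¹) with s = ι⁻¹ √3, s² = 3
  set s : PadicAlgCl 2 := ι.symm ((Real.sqrt 3 : ℝ) : ℂ) with hsdef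
  have hss : s * s = 3 := by rw [hsdef, ← map_mul, hs, map_ofNat]
  rw [Polynomial.coeff_zero_eq_eval_zero] at hc
  have hl : ((X - 1 : Polynomial (PadicAlgCl 2)) ^ 2).eval 0 = 1 := by simp
  rw [hl] at hc
  have h9 : (1 : PadicAlgCl 2) = (s * s)⁻¹ * (s * s)⁻¹ := by rw [hc]; ring
  rw [hss] at h9
  norm_num at h9

/-- `‖3/4‖₂ = 4` in `ℚ̄₂`. [folklore] -/
theorem norm_three_div_four : ‖(3 / 4 : PadicAlgCl 2)‖ = 4 := by
  haveI : Fact (Nat.Prime 2) := ⟨Nat.prime_two⟩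
  have hcoe : (3 / 4 : PadicAlgCl 2) = ((3 / 4 : ℚ_[2]) : PadicAlgCl 2) := by
    rw [map_div₀, map_ofNat, map_ofNat]
  have h3 : ‖(3 : ℚ_[2])‖ = 1 := by
    have hle : ‖((3 : ℤ) : ℚ_[2])‖ ≤ 1 := Padic.norm_int_le_one 3
    have hlt : ¬ ‖((3 : ℤ) : ℚ_[2])‖ < 1 := by
      rw [Padic.norm_intCast_lt_one_iff]
      norm_num
    have : ((3 : ℤ) : ℚ_[2]) = 3 := by norm_num
    rw [this] at hle hlt
    exact le_antisymm hle (not_lt.mp hlt)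
  have h4 : ‖(4 : ℚ_[2])‖ = 4⁻¹ := by
    have e : (4 : ℚ_[2]) = ((2 : ℕ) : ℚ_[2]) ^ 2 := by norm_num
    rw [e, norm_pow, Padic.norm_p]
    norm_num
  rw [hcoe, PadicAlgCl.norm_extends, norm_div, h3, h4]
  norm_num

/-- **`Odd q` is load-bearing in `stub_predictedPolyCongr`** (landed as
`Theorems/ResidualBianchiDoorLevel/Negative/PredictedPolyFalseWithoutOdd.lean`).  The stub with
`(hq : Odd q)` deleted (`q` explicit) is false: at `q = 2`, `k = 2`, `Q = H = (X - 1)²` the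
`X⁰`-coefficients of `Q` and of the prediction `(X - 1/2)²` differ by `3/4`, of 2-adic norm `4`.
So the congruence normalisation of E1′/E2′ only works at ODD residue characteristic — a kernel-checked
reason for `2 ∈ S₀`. [folklore] -/
theorem stub_predictedPolyCongr_false_without_odd :
    ¬ ∀ (ι : PadicAlgCl 2 ≃+* ℂ) (q : ℕ) (k : ℤ) (Q : Polynomial 𝒪[PadicAlgCl 2])
        (H : Polynomial ℂ), H.Monic → H.natDegree = 2 →
        Q.map (𝒪[PadicAlgCl 2]).subtype = H.map (ι.symm : ℂ →+* PadicAlgCl 2) →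
        ∀ i : ℕ, ‖(Q.map (𝒪[PadicAlgCl 2]).subtype).coeff i -
          (arithFrobPolyOfSatake ι q 2
            (H.roots.map fun β => (((Real.sqrt q : ℝ) : ℂ)) ^ (k - 1) * β⁻¹)).coeff i‖ < 1 := by
  haveI : Fact (Nat.Prime 2) := ⟨Nat.prime_two⟩
  intro h
  obtain ⟨ι⟩ := nonempty_ringEquiv_padicAlgCl_complex
  set Q : Polynomial 𝒪[PadicAlgCl 2] := (X - C 1) ^ 2 with hQdef
  set H : Polynomial ℂ := (X - C 1) ^ 2 with hHdef
  have hH : H.Monic := (monic_X_sub_C 1).pow 2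
  have hdeg : H.natDegree = 2 := by
    rw [hHdef, natDegree_pow, natDegree_X_sub_C]
  have hQmap : Q.map (𝒪[PadicAlgCl 2]).subtype = (X - C 1) ^ 2 := by
    rw [hQdef, Polynomial.map_pow, Polynomial.map_sub, map_X, map_C, map_one]
  have hHmap : H.map (ι.symm : ℂ →+* PadicAlgCl 2) = (X - C 1) ^ 2 := by
    rw [hHdef, Polynomial.map_pow, Polynomial.map_sub, map_X, map_C, RingHom.coe_coe, map_one]
  have hroots : H.roots = {1, 1} := by
    rw [hHdef, roots_pow, roots_X_sub_C]; rfl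
  have hs : ((Real.sqrt 2 : ℝ) : ℂ) * ((Real.sqrt 2 : ℝ) : ℂ) = 2 := by
    rw [← Complex.ofReal_mul, Real.mul_self_sqrt (by norm_num : (0:ℝ) ≤ 2)]
    norm_num
  have hpred : arithFrobPolyOfSatake ι 2 2
      (H.roots.map fun β => (((Real.sqrt (2 : ℕ) : ℝ) : ℂ)) ^ ((2 : ℤ) - 1) * β⁻¹) =
      (X - C (2⁻¹ : PadicAlgCl 2)) * (X - C (2⁻¹ : PadicAlgCl 2)) := by
    have hc : ι.symm ((((Real.sqrt (2 : ℕ) : ℝ) : ℂ)) ^ (2 - 1) *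
        ((((Real.sqrt (2 : ℕ) : ℝ) : ℂ)) ^ ((2 : ℤ) - 1) * (1 : ℂ)⁻¹))⁻¹ = (2⁻¹ : PadicAlgCl 2) := by
      norm_num
      rw [← mul_inv, ← map_mul, hs, map_ofNat]
      norm_num
    simp only [arithFrobPolyOfSatake, hroots, Multiset.insert_eq_cons, Multiset.map_cons,
      Multiset.map_singleton, Multiset.prod_cons, Multiset.prod_singleton, hc]
  have h0 := h ι 2 2 Q H hH hdeg (hQmap.trans hHmap.symm) 0
  rw [hQmap, hpred] at h0
  have e1 : ((X - C 1) ^ 2 : Polynomial (PadicAlgCl 2)).coeff 0 = 1 := by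
    rw [coeff_zero_eq_eval_zero]; simp
  have e2 : ((X - C (2⁻¹ : PadicAlgCl 2)) * (X - C (2⁻¹ : PadicAlgCl 2))).coeff 0 = 4⁻¹ := by
    rw [coeff_zero_eq_eval_zero]; norm_num
  rw [e1, e2, show (1 : PadicAlgCl 2) - 4⁻¹ = 3 / 4 by norm_num, norm_three_div_four] at h0
  norm_num at h0

end Summit.Langlands.Langlands.Cruxes.ResidualBianchiDoorLevel.Disproof

end
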